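import Literature.NumberTheory.EllipticCurves.ZpExtensionEisensteinPiLevelInvariantsBoundProofs
import Literature.NumberTheory.EllipticCurves.IwasawaAlgebraEisensteinScalarDichotomyProofs
import Literature.NumberTheory.EllipticCurves.IwasawaAlgebraEisensteinUniformIndexProofs
import Literature.NumberTheory.EllipticCurves.IwasawaAlgebraEisensteinTwistedInvariantsReadout
import Literature.NumberTheory.EllipticCurves.ZpExtensionScalarTwistFiniteProofs
import Literature.NumberTheory.EllipticCurves.IwasawaAlgebraEisensteinFiniteQuotientSpanProofs
import Literature.NumberTheory.GaloisRepresentations.LocalDualityTwoZeroEigenBoundProofs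
import Literature.NumberTheory.Automorphic.AdicCompletionLocalField
import HarnessLib

/-!
# `#H²(K_w, Fil_w(T/π^iT)) ≤ p^{p^s}`: the uniform `H²`-bound on the plus line of Howard's `π`-adic Eisenstein levels at a
# place above `p` (theorems only — no definition, no named fact, no instance, no `sorry`)

Topic `NumberTheory/EllipticCurves` (cell `pub/bsd-print-x9`, shared μ-crux `MuInequalityCoherentPairOfPrint`, registered stub
`stub_h5bAtS`; brick (F4c-3) of the uniform-`ι` road, x9-p1-w3 g6's target shape 2026-08-28T21:21:11Z:
«`Nat.card (continuousCohomology 2 ((GaloisRep.toLocal w (D.levelRep i)).subrepresentation (E.piFil κ hm Φ i) _).toTopRep) ≤ p ^ c₂`»).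

B. Howard, Compositio Math. 140 (2004), Lemma 3.2.7 (arXiv:1202.6340 p. 16 L150–156: the cokernel of the reduction on `H¹(K_v, Fil_v)`
«is controlled by `H²(K_v, Fil_v 𝐓)[𝔭]`, and by local duality it suffices to bound `H⁰(K_v, gr_v 𝐀)`») and §3.1.  For the curve's
`π`-adic refinement datum `D` (`ZpExtensionEisensteinPiRefinementCurve`), an ordinary datum `Φ` at `w ∣ p` on the torsion tower
(`Fil_w E[p^k]` CYCLIC with generator `P₀` on which `g₀ ∈ Γ_{K_w}` acts by an integer `λ`), `g₀` with `κ(g₀) = p^s` (`p^s < m`)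
acting on `μ_{p^k}` by an integer `c` prime to `p`:

* §1 helpers: `twistExponent_eq_of_toAdd_eq_natCast_pow` (`κ(g) = p^s`, `p^s < p^J` ⇒ the level-`J` exponent IS `p^s`);
  `pow_lt_pow_eisensteinLevel` (`p^s < m`, `k ≥ 1` ⇒ `p^s < p^{J(m,k)}`: otherwise `(1+T)^{p^J} = 1` forces `[T]^{m-1} = 0` in
  `A_{m,k}`, contradicting `λ_k([T^{m-1}]) = 1`);
* §2 **`WeierstrassCurve.natCard_two_piFil_le`** — **`H²(K_w, Fil_w(T/π^iT))` is finite of order `≤ p^{p^s}`** for every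
  `π`-adic exponent `i ≥ 1`: the plus part `piFil i` is the `S_𝔮`-line through `[1 ⊗ P₀]`, on which `g₀` acts by
  `μ = λ·(1+T)^{p^s}`; the scalar dichotomy (`IwasawaAlgebraEisensteinScalarDichotomyProofs`) gives `(μ − c)·ν = [T]^{p^s}`, so the
  generic one-element count `natCard_two_le_natCard_quotient_of_mu_apply_eq_smul` (`LocalDualityTwoZeroEigenBoundProofs`) bounds
  `#H²` by `#(piFil i ⧸ T^{p^s}·piFil i) ≤ #(S_𝔮 ⧸ (T^{p^s})) = p^{p^s}` (`natCard_quotient_span_mk_X_pow_eq`) — uniform in `i`,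
  `k`, `m` (the H²-exponent `c₂ = p^s < m/3` of the torsion-cut readout of `F_𝔮` at `w ∣ p`).

No summit statement is proved; BSD is not proved by any of this.

References: [Howard2004HeegnerKolyvagin] Lemma 3.2.7, §3.1, Def. 1.1.3, proof of Thm. 2.2.10; [MilneADT2006] I Cor. 2.3;
[GreenbergLNM1716] §2 and proof of Prop. 4.15; [Washington1997] §13.2.
-/

set_option autoImplicit false

noncomputable section

open Function NumberField IsDedekindDomain Field Polynomial
open scoped NumberField ContRepresentation

namespace Literature.NumberTheory.EllipticCurves

namespace ZpExtension

open IwasawaAlgebra IwasawaAlgebra.EisensteinCoeff Literature.NumberTheory.GaloisRepresentations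
open Literature.NumberTheory.GaloisRepresentations.DiscreteGaloisModule
open Literature.NumberTheory.GaloisCohomology.Howard2004 Literature.NumberTheory.Automorphic

/-! ## §1 Helpers: the exponent of `g₀` at the level of the twist -/

section Helpers

variable {p : ℕ} [hp : Fact p.Prime]

/-- If `κ(g) = p^s` and `p^s < p^J` then the level-`J` twist exponent of `g` is `p^s` on the nose.
[cite: Washington1997, §13.1–§13.2] -/
theorem twistExponent_eq_of_toAdd_eq_natCast_pow {K : Type} [Field K] (κ : ZpExtension K p) {J s : ℕ}
    (hsJ : p ^ s < p ^ J) {g : absoluteGaloisGroup K} (hg : (κ g).toAdd = ((p ^ s : ℕ) : ℤ_[p])) :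
    κ.twistExponent J g = p ^ s := by
  haveI : NeZero (p ^ J) := ⟨pow_ne_zero J hp.out.ne_zero⟩
  change (PadicInt.toZModPow J (κ g).toAdd).val = p ^ s
  rw [hg, map_natCast, ZMod.val_natCast, Nat.mod_eq_of_lt hsJ]

/-- **`p^s < p^{J(m,k)}`** for the exponent level `J(m,k)` of the twist over `A_{m,k}` (`k ≥ 1`, `p^s < m`): if `p^J ≤ p^s < m`
then `(1+T)^{p^J} − 1 = [T]^{p^J}·unit` vanishes in `A_{m,k}`, so `[T]^{m−1} = 0`, contradicting `λ_k([T^{m−1}]) = 1 ≠ 0` in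
`ℤ/p^k`. [cite: Washington1997, §13.2 (Lemma 13.7)] [cite: Howard2004HeegnerKolyvagin, proof of Thm. 2.2.10] -/
theorem pow_lt_pow_eisensteinLevel {m : ℕ} (hm : 1 ≤ m) {k : ℕ} (hk : 1 ≤ k) {s : ℕ} (hms : p ^ s < m) :
    p ^ s < p ^ eisensteinLevel (p := p) hm k := by
  by_contra hle
  rw [not_lt] at hle
  have hJm : p ^ eisensteinLevel (p := p) hm k < m := lt_of_le_of_lt hle hms
  obtain ⟨c, hc⟩ := onePlusT_pow_prime_pow_sub_one_eq p k (eisensteinLevel (p := p) hm k) hJm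
  rw [onePlusT_pow_prime_pow_eisensteinLevel (p := p) hm k, sub_self] at hc
  have hunit : IsUnit ((1 : EisensteinCoeff p m k) + Ideal.Quotient.mk _ PowerSeries.X * c) :=
    isUnit_add_mk_X_mul p isUnit_one c
  have hT : (Ideal.Quotient.mk _ PowerSeries.X : EisensteinCoeff p m k) ^ (p ^ eisensteinLevel (p := p) hm k) = 0 :=
    (hunit.mul_left_eq_zero).mp hc.symm
  -- `[T]^{m-1} = [T]^{p^J} · [T]^{m-1-p^J} = 0`
  have hTm : (Ideal.Quotient.mk _ ((PowerSeries.X : IwasawaAlgebra p) ^ (m - 1)) : EisensteinCoeff p m k) = 0 := by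
    obtain ⟨d, hd⟩ := Nat.exists_eq_add_of_le (Nat.le_sub_one_of_lt hJm)
    rw [hd, pow_add, map_mul, (Ideal.Quotient.mk _).map_pow PowerSeries.X (p ^ eisensteinLevel (p := p) hm k), hT, zero_mul]
  have h1 := EisensteinCoeff.tailFormZMod_mk_X_pow p hm k ⟨m - 1, Nat.sub_lt (by omega) zero_lt_one⟩
  rw [if_pos rfl] at h1
  change EisensteinCoeff.tailFormZMod p hm k (Ideal.Quotient.mk _ ((PowerSeries.X : IwasawaAlgebra p) ^ (m - 1))) = 1 at h1
  rw [hTm, map_zero] at h1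
  haveI : Fact (1 < p ^ k) := ⟨Nat.one_lt_pow (by omega) hp.out.one_lt⟩
  exact zero_ne_one h1

end Helpers

/-! ## §2 The plus line `piFil i`: `#H²(K_w, Fil_w(T/π^iT)) ≤ p^{p^s}` -/

variable {K : Type} [Field K] [NumberField K] (E : WeierstrassCurve K) [E.IsElliptic] {p : ℕ} [hp : Fact p.Prime]
  (κ' : ZpExtension K p) {m : ℕ} (hm : 1 ≤ m)

set_option maxHeartbeats 800000 in
/-- **`#H²(K_w, Fil_w(T/π^iT)) ≤ p^{p^s}`, uniformly in the level.**  `D` the curve's `π`-adic refinement datum, `Φ` an ordinary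
datum at `w` whose plus part `Fil_w E[p^k]` at the host level `k = host i` (`i ≥ 1`) is CYCLIC with generator `P₀` on which
`g₀ ∈ Γ_{K_w}` acts by the integer `λ`; `κ(g₀) = p^s` with `p^s < m`; `g₀` acts on `μ_{p^k}` by the integer `c`, `p ∤ c`.  Then
`H²(K_w, piFil i)` (the plus line of the `π`-adic level, as a subrepresentation of `Level i`) is finite of order `≤ p^{p^s}`.
[cite: Howard2004HeegnerKolyvagin, Lemma 3.2.7 (arXiv:1202.6340 p. 16 L150–156) and §3.1] [cite: MilneADT2006, Ch. I Cor. 2.3]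
[cite: GreenbergLNM1716, §2 and proof of Prop. 4.15] -/
theorem _root_.WeierstrassCurve.natCard_two_piFil_le
    {w : HeightOneSpectrum (𝓞 K)}
    (Φ : OrdinaryFiltration (fun j ↦ E.torsionGaloisModule ((p : ℤ) ^ j)) (fun j ↦ E.torsionGaloisModuleReduce p j) w)
    {i : ℕ} (hi : 1 ≤ i)
    (P₀ : E.geomTorsion ((p : ℤ) ^ (E.eisensteinPiRefinementDatum κ' hm).host i))
    (hP₀ : P₀ ∈ Φ.fil ((E.eisensteinPiRefinementDatum κ' hm).host i))
    (hgen : ∀ a ∈ Φ.fil ((E.eisensteinPiRefinementDatum κ' hm).host i), ∃ n : ℤ, n • P₀ = a)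
    {g₀ : absoluteGaloisGroup (w.adicCompletion K)} {s : ℕ}
    (hg₀ : (κ' (absGaloisRestrict K (w.adicCompletion K) g₀)).toAdd = ((p ^ s : ℕ) : ℤ_[p])) (hms : p ^ s < m)
    (lam : ℤ) (hlam : E.torsionGaloisModule ((p : ℤ) ^ (E.eisensteinPiRefinementDatum κ' hm).host i)
      (absGaloisRestrict K (w.adicCompletion K) g₀) P₀ = lam • P₀)
    (c : ℤ) (hc : ∀ ζ : MuCarrier (w.adicCompletion K) (p ^ (E.eisensteinPiRefinementDatum κ' hm).host i),
      mu (w.adicCompletion K) (p ^ (E.eisensteinPiRefinementDatum κ' hm).host i) g₀ ζ = c • ζ)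
    (hcp : ¬ (p : ℤ) ∣ c) :
    Finite (continuousCohomology 2 ((GaloisRep.toLocal w ((E.eisensteinPiRefinementDatum κ' hm).levelRep i)).subrepresentation
        (E.piFil κ' hm Φ i) (E.piFil_le_comap κ' hm Φ i)).toTopRep) ∧
      Nat.card (continuousCohomology 2 ((GaloisRep.toLocal w ((E.eisensteinPiRefinementDatum κ' hm).levelRep i)).subrepresentation
        (E.piFil κ' hm Φ i) (E.piFil_le_comap κ' hm Φ i)).toTopRep) ≤ p ^ (p ^ s) := by
  classical
  haveI : CharZero (w.adicCompletion K) := charZero_of_injective_algebraMap (algebraMap K _).injective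
  -- ### abbreviations
  have hk : 1 ≤ (E.eisensteinPiRefinementDatum κ' hm).host i := by
    rw [WeierstrassCurve.eisensteinPiRefinementDatum_host]
    exact (Nat.le_div_iff_mul_le hm).mpr (by omega)
  -- the host level `k`, its module `N_k = E[p^k] ⊗ A_{m,k}` and the class `x₀ = [1 ⊗ P₀]`
  haveI hfinE : Finite (E.geomTorsion ((p : ℤ) ^ (E.eisensteinPiRefinementDatum κ' hm).host i)) :=
    WeierstrassCurve.finite_torsionPoints_holds E (AlgebraicClosure K) (pow_ne_zero _ (by exact_mod_cast hp.out.ne_zero))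
  haveI hfinN : Finite (EisensteinLevel p m (fun j ↦ E.geomTorsion ((p : ℤ) ^ j)) ((E.eisensteinPiRefinementDatum κ' hm).host i)) :=
    EisensteinCoeff.finite_twisted (p := p) (k := (E.eisensteinPiRefinementDatum κ' hm).host i) hm
  haveI hfinL : Finite ((E.eisensteinPiRefinementDatum κ' hm).Level i) :=
    Finite.of_surjective _ (Submodule.Quotient.mk_surjective _)
  let t₀ : EisensteinLevel p m (fun j ↦ E.geomTorsion ((p : ℤ) ^ j)) ((E.eisensteinPiRefinementDatum κ' hm).host i) :=
    EisensteinCoeff.Twisted.tmul (1 : EisensteinCoeff p m ((E.eisensteinPiRefinementDatum κ' hm).host i)) P₀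
  let x₀ : (E.eisensteinPiRefinementDatum κ' hm).Level i := Submodule.Quotient.mk t₀
  have ht₀ : (t₀ : Twisted p m ((E.eisensteinPiRefinementDatum κ' hm).host i)
      (E.geomTorsion ((p : ℤ) ^ (E.eisensteinPiRefinementDatum κ' hm).host i))) ∈
        Φ.twistedFil (p := p) (m := m) ((E.eisensteinPiRefinementDatum κ' hm).host i) :=
    Φ.tmul_mem_twistedFil _ 1 hP₀
  have hx₀ : x₀ ∈ E.piFil κ' hm Φ i := (E.mem_piFil_iff κ' hm Φ i x₀).mpr ⟨t₀, ht₀, rfl⟩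
  -- ### the `S_𝔮`-action preserves `piFil i`
  have hSmem : ∀ (a : IwasawaAlgebra p ⧸ Ideal.span {(PowerSeries.X ^ m + PowerSeries.C (p : ℤ_[p]) : IwasawaAlgebra p)})
      (y : (E.eisensteinPiRefinementDatum κ' hm).Level i), y ∈ E.piFil κ' hm Φ i → a • y ∈ E.piFil κ' hm Φ i := by
    intro a y hy
    obtain ⟨f, rfl⟩ := Ideal.Quotient.mk_surjective a
    obtain ⟨z, hz, rfl⟩ := (E.mem_piFil_iff κ' hm Φ i y).mp hy
    rw [← Submodule.Quotient.mk_smul]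
    refine (E.mem_piFil_iff κ' hm Φ i _).mpr ⟨_, ?_, rfl⟩
    rw [EisensteinLevel.quotient_mk_smul_def]
    exact Φ.smul_mem_twistedFil _ _ hz
  -- ### every element of `Fil_w W_{m,k}` is an `A_{m,k}`-multiple of `1 ⊗ P₀` (the plus part is a line)
  have hline : ∀ z : Twisted p m ((E.eisensteinPiRefinementDatum κ' hm).host i)
      (E.geomTorsion ((p : ℤ) ^ (E.eisensteinPiRefinementDatum κ' hm).host i)),
      z ∈ Φ.twistedFil (p := p) (m := m) ((E.eisensteinPiRefinementDatum κ' hm).host i) →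
        ∃ a : EisensteinCoeff p m ((E.eisensteinPiRefinementDatum κ' hm).host i),
          a • (EisensteinCoeff.Twisted.tmul (1 : EisensteinCoeff p m _) P₀ : Twisted p m _ _) = z := by
    intro z hz
    induction hz using Submodule.span_induction with
    | mem x hx =>
      obtain ⟨c', a, ha, rfl⟩ := hx
      obtain ⟨n, rfl⟩ := hgen a ha
      refine ⟨n • c', ?_⟩
      rw [← Twisted.zsmul_tmul n c' P₀, Twisted.tmul_eq_smul_tmul_one (n • c') P₀]
    | zero => exact ⟨0, zero_smul _ _⟩
    | add x y _ _ hx hy =>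
      obtain ⟨a, rfl⟩ := hx
      obtain ⟨b, rfl⟩ := hy
      exact ⟨a + b, add_smul a b _⟩
    | smul n x _ hx =>
      obtain ⟨a, rfl⟩ := hx
      exact ⟨n • a, smul_assoc n a _⟩
  -- ### the exponent of `g₀` at the host level is `p^s`
  have hJ : p ^ s < p ^ eisensteinLevel (p := p) hm ((E.eisensteinPiRefinementDatum κ' hm).host i) :=
    pow_lt_pow_eisensteinLevel hm hk hms
  have he : κ'.twistExponent (eisensteinLevel (p := p) hm ((E.eisensteinPiRefinementDatum κ' hm).host i))
      (absGaloisRestrict K (w.adicCompletion K) g₀) = p ^ s :=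
    twistExponent_eq_of_toAdd_eq_natCast_pow κ' hJ hg₀
  -- ### the scalars: `μ = λ (1+T)^{p^s}`, `ν`, `π^{p^s}` as elements of `S_𝔮`
  let Sq := IwasawaAlgebra p ⧸ Ideal.span {(PowerSeries.X ^ m + PowerSeries.C (p : ℤ_[p]) : IwasawaAlgebra p)}
  let mkS : IwasawaAlgebra p →+* Sq := Ideal.Quotient.mk _
  let mkA : IwasawaAlgebra p →+* EisensteinCoeff p m ((E.eisensteinPiRefinementDatum κ' hm).host i) := Ideal.Quotient.mk _
  have hSA : ∀ (f : IwasawaAlgebra p)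
      (y : EisensteinLevel p m (fun j ↦ E.geomTorsion ((p : ℤ) ^ j)) ((E.eisensteinPiRefinementDatum κ' hm).host i)),
      mkS f • y = mkA f • y := fun f y ↦ EisensteinLevel.quotient_mk_smul_def _ f y
  let fμ : IwasawaAlgebra p := (lam : IwasawaAlgebra p) * ((1 : IwasawaAlgebra p) + PowerSeries.X) ^ (p ^ s)
  obtain ⟨νA, hνA⟩ := exists_intCast_mul_onePlusT_pow_sub_intCast_mul_eq_mk_X_pow p
    ((E.eisensteinPiRefinementDatum κ' hm).host i) s hms lam c hcp
  obtain ⟨fν, hfν⟩ := Ideal.Quotient.mk_surjective νA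
  have hmkA_fμ : mkA fμ = (lam : EisensteinCoeff p m _) * onePlusT p m _ ^ (p ^ s) := by
    simp only [mkA, fμ, map_mul, map_intCast, map_pow, onePlusT_def]
  have hA : mkA ((fμ - (c : IwasawaAlgebra p)) * fν) = mkA (PowerSeries.X ^ (p ^ s)) := by
    rw [map_mul, map_sub, map_intCast, hmkA_fμ]
    change _ * (Ideal.Quotient.mk _ fν) = _
    rw [hfν, hνA]
    exact (map_pow mkA PowerSeries.X (p ^ s)).symm
  -- `((μ − c) ν) • y = π^{p^s} • y` on the host level module and on the `π`-adic level
  have hθνN : ∀ y : EisensteinLevel p m (fun j ↦ E.geomTorsion ((p : ℤ) ^ j)) ((E.eisensteinPiRefinementDatum κ' hm).host i),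
      ((mkS fμ - (c : Sq)) * mkS fν) • y = mkS (PowerSeries.X ^ (p ^ s)) • y := by
    intro y
    have h1 : (mkS fμ - (c : Sq)) * mkS fν = mkS ((fμ - (c : IwasawaAlgebra p)) * fν) := by
      rw [← map_intCast mkS c, ← map_sub, ← map_mul]
    rw [h1, hSA, hSA, hA]
  have hθν : ∀ y : (E.eisensteinPiRefinementDatum κ' hm).Level i,
      ((mkS fμ - (c : Sq)) * mkS fν) • y = mkS (PowerSeries.X ^ (p ^ s)) • y := by
    intro y
    induction y using Submodule.Quotient.induction_on with
    | _ y => rw [← Submodule.Quotient.mk_smul, ← Submodule.Quotient.mk_smul, hθνN]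
  -- ### the action of `g₀` on the generator: `g₀ · [1 ⊗ P₀] = μ • [1 ⊗ P₀]`
  have hρt₀ : κ'.eisensteinTwist (E.torsionGaloisModule ((p : ℤ) ^ (E.eisensteinPiRefinementDatum κ' hm).host i)) hm
      ((E.eisensteinPiRefinementDatum κ' hm).host i) (absGaloisRestrict K (w.adicCompletion K) g₀)
      (Twisted.tmul (1 : EisensteinCoeff p m ((E.eisensteinPiRefinementDatum κ' hm).host i)) P₀) =
      ((lam : EisensteinCoeff p m ((E.eisensteinPiRefinementDatum κ' hm).host i)) *
          onePlusT p m ((E.eisensteinPiRefinementDatum κ' hm).host i) ^ (p ^ s)) •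
        (Twisted.tmul (1 : EisensteinCoeff p m ((E.eisensteinPiRefinementDatum κ' hm).host i)) P₀ :
          Twisted p m ((E.eisensteinPiRefinementDatum κ' hm).host i)
            (E.geomTorsion ((p : ℤ) ^ (E.eisensteinPiRefinementDatum κ' hm).host i))) := by
    rw [κ'.eisensteinTwist_apply_tmul, he, mul_one]
    rw [hlam, ← Twisted.zsmul_tmul, Twisted.smul_tmul, mul_one, zsmul_eq_mul]
  have hτx₀ : GaloisRep.toLocal w ((E.eisensteinPiRefinementDatum κ' hm).levelRep i) g₀ x₀ = mkS fμ • x₀ := by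
    change GaloisRep.toLocal w ((E.eisensteinPiRefinementDatum κ' hm).levelRep i) g₀ (Submodule.Quotient.mk t₀) =
      mkS fμ • Submodule.Quotient.mk t₀
    rw [GaloisRep.toLocal_apply, PiRefinementDatum.levelRep_apply_mk, ← Submodule.Quotient.mk_smul, hSA, hmkA_fμ]
    exact congrArg _ hρt₀
  have hlin : ∀ (σ : absoluteGaloisGroup K) (a : Sq) (y : (E.eisensteinPiRefinementDatum κ' hm).Level i),
      (E.eisensteinPiRefinementDatum κ' hm).levelRep i σ (a • y) = a • (E.eisensteinPiRefinementDatum κ' hm).levelRep i σ y :=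
    (E.eisensteinPiRefinementDatum κ' hm).isScalarLinear_levelRep i
  -- ### the subrepresentation `X = piFil i`, killed by `p^k`
  have hM : ∀ x : E.piFil κ' hm Φ i, p ^ ((E.eisensteinPiRefinementDatum κ' hm).host i) • x = 0 := by
    intro x
    apply Subtype.ext
    rw [Submodule.coe_smul_of_tower, Submodule.coe_zero]
    obtain ⟨y, hy⟩ := Submodule.Quotient.mk_surjective _ (x : (E.eisensteinPiRefinementDatum κ' hm).Level i)
    have h0 : p ^ ((E.eisensteinPiRefinementDatum κ' hm).host i) • y = 0 :=
      EisensteinCoeff.prime_pow_nsmul_twisted (p := p) (m := m)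
        (y : Twisted p m _ (E.geomTorsion ((p : ℤ) ^ (E.eisensteinPiRefinementDatum κ' hm).host i)))
    have h1 : ((p ^ ((E.eisensteinPiRefinementDatum κ' hm).host i) : ℕ) : Sq) •
        (Submodule.Quotient.mk y : (E.eisensteinPiRefinementDatum κ' hm).Level i) = 0 := by
      rw [← Submodule.Quotient.mk_smul, Nat.cast_smul_eq_nsmul, h0, Submodule.Quotient.mk_zero]
    rw [← hy, ← Nat.cast_smul_eq_nsmul Sq, h1]
  -- ### the coordinate map `q : S_𝔮 → piFil i`, `a ↦ a • x₀`, onto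
  let q : Sq →+ E.piFil κ' hm Φ i :=
    AddMonoidHom.mk' (fun a ↦ ⟨a • x₀, hSmem a x₀ hx₀⟩) (fun a b ↦ Subtype.ext (add_smul a b x₀))
  have hq : ∀ a : Sq, ((q a : E.piFil κ' hm Φ i) : (E.eisensteinPiRefinementDatum κ' hm).Level i) = a • x₀ := fun _ ↦ rfl
  have hqsurj : Surjective q := by
    intro x
    obtain ⟨z, hz, hzx⟩ := (E.mem_piFil_iff κ' hm Φ i _).mp x.2
    obtain ⟨aA, haA⟩ := hline _ hz
    obtain ⟨f, rfl⟩ := Ideal.Quotient.mk_surjective aA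
    refine ⟨mkS f, Subtype.ext ?_⟩
    rw [hq, ← hzx]
    change mkS f • (Submodule.Quotient.mk t₀ : (E.eisensteinPiRefinementDatum κ' hm).Level i) = Submodule.Quotient.mk z
    rw [← Submodule.Quotient.mk_smul, hSA]
    exact congrArg _ haA
  -- ### `R = π^{p^s} · piFil i` and the eigen-cochain identity
  let I : Ideal Sq := Ideal.span {mkS (PowerSeries.X ^ (p ^ s))}
  let R : AddSubgroup (E.piFil κ' hm Φ i) := I.toAddSubgroup.map q
  have hR : ∀ r ∈ R, ∃ v : E.piFil κ' hm Φ i,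
      (GaloisRep.toLocal w ((E.eisensteinPiRefinementDatum κ' hm).levelRep i)).subrepresentation (E.piFil κ' hm Φ i)
        (E.piFil_le_comap κ' hm Φ i) g₀ v - c • v = r := by
    rintro _ ⟨a, ha, rfl⟩
    obtain ⟨b, rfl⟩ := Ideal.mem_span_singleton'.mp ha
    refine ⟨q (b * mkS fν), Subtype.ext ?_⟩
    rw [Submodule.coe_sub, Submodule.coe_smul_of_tower, ContinuousRep.subrepresentation_apply_coe, hq, hq,
      GaloisRep.toLocal_apply, hlin, ← GaloisRep.toLocal_apply, hτx₀]
    calc (b * mkS fν) • mkS fμ • x₀ - c • (b * mkS fν) • x₀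
        = (b * mkS fν * mkS fμ) • x₀ - ((c : Sq) * (b * mkS fν)) • x₀ := by
          rw [mul_smul (b * mkS fν) (mkS fμ) x₀, mul_smul (c : Sq) (b * mkS fν) x₀, Int.cast_smul_eq_zsmul]
      _ = (b * ((mkS fμ - (c : Sq)) * mkS fν)) • x₀ :=
          (sub_smul (b * mkS fν * mkS fμ) ((c : Sq) * (b * mkS fν)) x₀).symm.trans (congrArg (· • x₀) (by ring))
      _ = (b * mkS (PowerSeries.X ^ (p ^ s))) • x₀ :=
          (mul_smul b _ x₀).trans ((congrArg (b • ·) (hθν x₀)).trans (mul_smul b _ x₀).symm)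
  -- ### local duality + the count
  obtain ⟨hfin, hle⟩ := natCard_two_le_natCard_quotient_of_mu_apply_eq_smul (w.adicCompletion K)
    ((GaloisRep.toLocal w ((E.eisensteinPiRefinementDatum κ' hm).levelRep i)).subrepresentation (E.piFil κ' hm Φ i)
      (E.piFil_le_comap κ' hm Φ i)) hM g₀ c hc R hR
  refine ⟨hfin, hle.trans ?_⟩
  have hcardS : Nat.card (Sq ⧸ I) = p ^ (p ^ s) := natCard_quotient_span_mk_X_pow_eq p hms
  haveI : Finite (Sq ⧸ I) := Nat.finite_of_card_ne_zero (by rw [hcardS]; exact pow_ne_zero _ hp.out.ne_zero)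
  have hfinI : Finite (Sq ⧸ I.toAddSubgroup) := ‹Finite (Sq ⧸ I)›
  let qbar : Sq ⧸ I.toAddSubgroup →+ (E.piFil κ' hm Φ i) ⧸ R :=
    QuotientAddGroup.map _ R q (fun a ha ↦ AddSubgroup.mem_map_of_mem q ha)
  have hqbar : Surjective qbar := by
    intro y
    induction y using QuotientAddGroup.induction_on with
    | H x =>
      obtain ⟨a, rfl⟩ := hqsurj x
      exact ⟨QuotientAddGroup.mk a, by rw [QuotientAddGroup.map_mk]⟩
  calc Nat.card (↥(E.piFil κ' hm Φ i) ⧸ R) ≤ Nat.card (Sq ⧸ I.toAddSubgroup) := Nat.card_le_card_of_surjective qbar hqbar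
    _ = Nat.card (Sq ⧸ I) := rfl
    _ = p ^ (p ^ s) := hcardS

end ZpExtension

end Literature.NumberTheory.EllipticCurves
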